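import Mathlib
import HarnessLib
import Literature.AlgebraicGeometry.Limits.IdealSheafExtension
import Literature.AlgebraicGeometry.Resolution.MarkedIdealsLemmas
import Summits.ResolutionOfSingularities.ResolutionOfSingularities.Theorems.WildQuotientsWildQuotientResolutionBlowupLocalExit

/-!
# Lemma G — gluing isolated local blow-ups into one global resolution (S2 brick F7 `IsolatedBlowupGlue`)

(crux stmt-ResolutionOfSingularities-15640 `WildQuotients.WildQuotientResolution`, line `Sketch`;
post-V5 rung S2 = the conductor-𝟙 core `ConductorOneCore p n` (res-L1-w45c-lead-1 g5,
`L/res-L1-w45c-lead-1/S2-DESIGN.md` §4 «Gluing (generic, NEW small lemma G)» / §6 brick F7).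
[OURS · L1 W4.5c] — NOT a statement of any manuscript; replaces the role of no printed item.
Def-free, generic scheme gluing. Prover res-L1-w45c-stub-3.)

* `BlowupExit.comap_finsetProd` — `comap` along a morphism commutes with finite products of ideal
  sheaves (Literature `comap_mul`);
* `BlowupExit.comap_map_eq_top_of_disjoint` — the push-forward along an open `U_j ↪ Y` of an ideal
  sheaf whose support has closure DISJOINT from `U_i` pulls back to `⊤` on `U_i`;
* **`BlowupExit.hasResolution_of_isolated_local_blowups`** — lemma G: `Y` integral, locally
  Noetherian, covered by finitely many opens `U_i` (quasi-compact inclusions) carrying ideal sheaves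
  `𝔞_i ≠ ⊥` whose supports have closures pairwise isolated (`closure (supp 𝔞_i) ∩ U_j = ∅`, `i ≠ j`);
  if SOME blow-up of each `U_i` along `𝔞_i` is regular, `Y` has a resolution of singularities —
  blow up `Y` along `𝓘 := ∏ᵢ (𝔞_i)_* ` (Mathlib `IdealSheafData.map`): `𝓘|_{U_i} = 𝔞_i`
  (`Literature…Limits.comap_map_of_isOpenImmersion` for the own factor, `⊤` for the others), then
  `BlowupExit.hasResolution_of_isBlowup_locally_regular`.
-/

-- single-problem summit: the doubled namespace component `ResolutionOfSingularities` is forced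
set_option linter.dupNamespace false

noncomputable section

open CategoryTheory AlgebraicGeometry TopologicalSpace
open Literature.AlgebraicGeometry.Resolution

namespace Summit.ResolutionOfSingularities.ResolutionOfSingularities.Theorems.WildQuotientResolution.BlowupExit

universe u

/-- `comap` along a morphism commutes with finite products of ideal sheaves. [folklore] -/
theorem comap_finsetProd {X Y : Scheme.{u}} (f : X ⟶ Y) {α : Type*} (s : Finset α)
    (J : α → Y.IdealSheafData) :
    (∏ a ∈ s, J a).comap f = ∏ a ∈ s, (J a).comap f := by
  classical
  induction s using Finset.induction_on with
  | empty => rw [Finset.prod_empty, Finset.prod_empty, Scheme.IdealSheafData.one_eq_top,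
      Scheme.IdealSheafData.comap_top]; rfl
  | insert a s ha ih => rw [Finset.prod_insert ha, Finset.prod_insert ha, comap_mul, ih]

/-- **A push-forward with isolated support pulls back to `⊤` elsewhere**: for opens `U_i, U_j` of
`Y` and an ideal sheaf `𝔞` on `U_j` with `closure (U_j.ι '' supp 𝔞)` disjoint from `U_i`, the
ideal sheaf `(𝔞.map U_j.ι).comap U_i.ι` is `⊤`. [folklore] -/
theorem comap_map_eq_top_of_disjoint {Y : Scheme.{u}} (Ui Uj : Y.Opens) [QuasiCompact Uj.ι]
    (𝔞 : (Uj : Scheme.{u}).IdealSheafData)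
    (h : Disjoint (Ui : Set Y) (closure (Uj.ι.base '' (𝔞.support : Set (Uj : Scheme.{u}))))) :
    (𝔞.map Uj.ι).comap Ui.ι = ⊤ := by
  rw [← Scheme.IdealSheafData.support_eq_bot_iff, Scheme.IdealSheafData.support_comap,
    Scheme.IdealSheafData.support_map]
  ext x
  simp only [Closeds.coe_preimage, Closeds.coe_closure, Set.mem_preimage, Closeds.coe_bot,
    Set.mem_empty_iff_false, iff_false]
  intro hx
  exact Set.disjoint_left.mp h x.2 hx

/-- **Lemma G — isolated local blow-ups glue to a resolution.** Let `Y` be an integral locally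
Noetherian scheme covered by finitely many opens `U_i` with quasi-compact inclusions, `𝔞_i ≠ ⊥` an
ideal sheaf on `U_i` whose support has closure in `Y` disjoint from every other `U_j`, and suppose
that for every `i` SOME blow-up of `U_i` along `𝔞_i` is regular. Then `Y` has a resolution of
singularities: the blow-up of `Y` along `𝓘 = ∏ᵢ (𝔞_i)_*` restricts over `U_i` to a blow-up along
`𝔞_i`. [OURS · L1 W4.5c; S2-DESIGN §4 lemma G] [folklore] -/
theorem hasResolution_of_isolated_local_blowups {Y : Scheme.{u}} [IsIntegral Y]
    [IsLocallyNoetherian Y] {ι : Type} [Finite ι] (U : ι → Y.Opens) (hU : ⨆ i, U i = ⊤)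
    [∀ i, QuasiCompact (U i).ι] (𝔞 : ∀ i, ((U i : Y.Opens) : Scheme.{u}).IdealSheafData)
    (h𝔞 : ∀ i, 𝔞 i ≠ ⊥)
    (hiso : ∀ i j, i ≠ j → Disjoint ((U j : Y.Opens) : Set Y)
      (closure ((U i).ι.base '' ((𝔞 i).support : Set ((U i : Y.Opens) : Scheme.{u})))))
    (h : ∀ i, ∃ (B : Scheme.{u}) (p : B ⟶ (U i : Y.Opens)), IsBlowup p (𝔞 i) ∧ Scheme.IsRegular B) :
    Scheme.HasResolution Y := by
  classical
  let _ : Fintype ι := Fintype.ofFinite ι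
  -- the global centre
  let 𝓘 : Y.IdealSheafData := ∏ i, (𝔞 i).map (U i).ι
  -- its restriction to `U i` is `𝔞 i`
  have hres : ∀ i, 𝓘.comap (U i).ι = 𝔞 i := by
    intro i
    rw [show 𝓘 = ∏ j ∈ Finset.univ, (𝔞 j).map (U j).ι from rfl, comap_finsetProd,
      ← Finset.mul_prod_erase _ _ (Finset.mem_univ i),
      Literature.AlgebraicGeometry.Limits.comap_map_of_isOpenImmersion (U i).ι (𝔞 i)]
    rw [Finset.prod_eq_one fun j hj => ?_, Scheme.IdealSheafData.one_eq_top,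
      Scheme.IdealSheafData.mul_top]
    rw [Scheme.IdealSheafData.one_eq_top]
    exact comap_map_eq_top_of_disjoint (U i) (U j) (𝔞 j) (hiso j i (Finset.ne_of_mem_erase hj))
  -- `𝓘 ≠ ⊥`: `Y` is non-empty, so some `U i` is, and `𝓘|_{U i} = 𝔞 i ≠ ⊥`
  have h𝓘 : 𝓘 ≠ ⊥ := by
    obtain ⟨y⟩ := (inferInstance : Nonempty Y)
    have hy : y ∈ (⨆ i, U i : Y.Opens) := by rw [hU]; trivial
    obtain ⟨i, -⟩ := Opens.mem_iSup.mp hy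
    intro hbot
    apply h𝔞 i
    rw [← hres i, hbot, Scheme.IdealSheafData.comap_bot]
  exact hasResolution_of_isBlowup_locally_regular 𝓘 h𝓘 U hU fun i => by
    rw [hres i]; exact h i

end Summit.ResolutionOfSingularities.ResolutionOfSingularities.Theorems.WildQuotientResolution.BlowupExit

end
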